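import Mathlib
import HarnessLib

/-!
# Coupon collecting: `E(τ) = n Σ_{k=1}^{n} 1/k` from the first-step recursion (Levin–Peres–Wilmer Prop. 2.3)

HONEST FRAMING: exact (Metropolis-corrected) sampling algorithms for lattice gauge theory; figures
of merit are autocorrelation/cost numbers at stated couplings and volumes; no continuum-physics claim.

Source: D. A. Levin, Y. Peres (with E. L. Wilmer), *Markov Chains and Mixing Times*, 2nd ed.,
AMS 2017 [LevinPeres2017], §2.2 "Coupon Collecting", PROPOSITION 2.3 with eq. (2.5) and its proof,
p. 22 ("if there are `k − 1` distinct types … then `P(X_{t+1} = k | X_t = k − 1) = (n − k + 1)/n`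
and `P(X_{t+1} = k − 1 | X_t = k − 1) = (k − 1)/n`"; "`E(τ) = Σ_k E(τ_k) = n Σ_{k=1}^{n} 1/k`").
Everything is PROVED (0 named facts, 0 definitions).

As in `GamblersRuin.lean` / `BiasedGamblersRuin.lean`, what is formalised is the SOLVING STEP of
the first-step analysis for the counting chain `X_t = #{types collected}` on `{0, …, n}`: writing
`e_j` for the expected remaining time from `j` collected types, the transition probabilities above
give `e_n = 0` and `e_j = 1 + (j/n) e_j + ((n − j)/n) e_{j+1}` (`0 ≤ j < n`); every solution is
`e_j = n Σ_{m=1}^{n−j} 1/m` — in particular **`E(τ) = e_0 = n Σ_{k=1}^{n} 1/k`** (2.5).  The book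
sums the expectations of the geometric waiting times `τ_k − τ_{k−1}` (mean `n/(n − k + 1)`); the
recursion `e_{k−1} − e_k = n/(n − k + 1)` proved here is that statement stage by stage.

* `coupon_step` — `e_j − e_{j+1} = n/(n − j)` [cite: LevinPeres2017, §2.2, proof of Prop. 2.3
  ("`τ_k − τ_{k−1}` is a geometric random variable with success probability `(n−k+1)/n`")];
* **PROPOSITION 2.3, EQ. (2.5)** `LevinPeres2017_prop_2_3` — `e_j = n Σ_{m=1}^{n−j} 1/m`, hence
  `e_0 = n Σ_{k=1}^{n} 1/k` (`LevinPeres2017_eq_2_5`) [cite: LevinPeres2017, §2.2 Prop. 2.3, eq. (2.5)].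
* **PROPOSITION 2.4, EQ. (2.7) — the estimate** `LevinPeres2017_prop_2_4_estimate`: for `n ≥ 1`
  types and `t ≥ n log n + cn` draws, `n(1 − 1/n)^t ≤ e^{−c}` — the union bound's right-hand side
  `Σ_{i=1}^{n} P(A_i) = n(1 − n⁻¹)^{⌈n log n + cn⌉} ≤ n exp(−(n log n + cn)/n) = e^{−c}` as printed
  (appended) [cite: LevinPeres2017, §2.2 Prop. 2.4, eq. (2.7) and its proof, p. 23].
NOT CLAIMED: the first-step / geometric-waiting-time derivation on the trajectory space, and the
union-bound step `P{τ > t} ≤ Σ_i P(A_i)` of Prop. 2.4 (events on the trajectory space).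

Context (cell pub-lqcd): `n log n` is the cost of visiting all of `n` equally likely targets by
independent proposals — the baseline against which sector-visiting times of samplers are read.
-/

namespace Literature.Probability.MarkovChains

open Finset

/-- One stage of coupon collecting: from the recursion `e_j = 1 + (j/n)e_j + ((n−j)/n)e_{j+1}`
(`j < n`), **`e_j − e_{j+1} = n/(n − j)`** — the mean of the geometric waiting time for a new type.
[cite: LevinPeres2017, §2.2, proof of Prop. 2.3] -/
theorem coupon_step {n : ℕ} {e : ℕ → ℝ} {j : ℕ} (hj : j < n)
    (hrec : e j = 1 + (j : ℝ) / n * e j + ((n : ℝ) - j) / n * e (j + 1)) :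
    e j - e (j + 1) = (n : ℝ) / ((n : ℝ) - j) := by
  have hn : (n : ℝ) ≠ 0 := Nat.cast_ne_zero.2 (by omega)
  have hnj : (n : ℝ) - j ≠ 0 := by
    have : (j : ℝ) < n := by exact_mod_cast hj
    linarith
  rw [eq_div_iff hnj]
  field_simp at hrec
  linarith

/-- **PROPOSITION 2.3 (solved recursion)**: if `e_n = 0` and `e_j = 1 + (j/n)e_j + ((n−j)/n)e_{j+1}`
for `0 ≤ j < n`, then **`e_j = n Σ_{m=1}^{n−j} 1/m`** for `0 ≤ j ≤ n` (written with
`m = i + 1`, `i < n − j`). [cite: LevinPeres2017, §2.2 Prop. 2.3] -/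
theorem LevinPeres2017_prop_2_3 {n : ℕ} {e : ℕ → ℝ} (hen : e n = 0)
    (hrec : ∀ j, j < n → e j = 1 + (j : ℝ) / n * e j + ((n : ℝ) - j) / n * e (j + 1)) :
    ∀ j, j ≤ n → e j = n * ∑ i ∈ range (n - j), 1 / ((i : ℝ) + 1) := by
  -- downward induction on `j`, phrased as induction on `d = n − j`
  suffices h : ∀ d, d ≤ n → e (n - d) = n * ∑ i ∈ range d, 1 / ((i : ℝ) + 1) by
    intro j hj
    have := h (n - j) (by omega)
    rwa [Nat.sub_sub_self hj] at this
  intro d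
  induction d with
  | zero => intro _; simp [hen]
  | succ d ih =>
    intro hd
    have hj : n - (d + 1) < n := by omega
    have hstep := coupon_step hj (hrec _ hj)
    have hsucc : n - (d + 1) + 1 = n - d := by omega
    rw [hsucc] at hstep
    rw [sum_range_succ, mul_add, ← ih (by omega)]
    have hcast : ((n : ℝ) - ((n - (d + 1) : ℕ) : ℝ)) = (d : ℝ) + 1 := by
      rw [Nat.cast_sub (by omega)]
      push_cast
      ring
    rw [hcast] at hstep
    have hd1 : (d : ℝ) + 1 ≠ 0 := by positivity
    rw [mul_one_div]
    linarith

/-- **EQ. (2.5): `E(τ) = n Σ_{k=1}^{n} 1/k`** — the case `j = 0` (no type collected yet).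
[cite: LevinPeres2017, §2.2 Prop. 2.3, eq. (2.5)] -/
theorem LevinPeres2017_eq_2_5 {n : ℕ} {e : ℕ → ℝ} (hen : e n = 0)
    (hrec : ∀ j, j < n → e j = 1 + (j : ℝ) / n * e j + ((n : ℝ) - j) / n * e (j + 1)) :
    e 0 = n * ∑ k ∈ range n, 1 / ((k : ℝ) + 1) := by
  have := LevinPeres2017_prop_2_3 hen hrec 0 (Nat.zero_le n)
  rwa [Nat.sub_zero] at this

/-! ## Proposition 2.4: the tail estimate (appended) -/

/-- `(1 − 1/n)^t ≤ exp(−t/n)` ("each trial has probability `1 − n⁻¹` of not drawing coupon `i`";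
`1 − x ≤ e^{−x}`). [cite: LevinPeres2017, §2.2, proof of Prop. 2.4] -/
theorem one_sub_inv_pow_le_exp {n : ℕ} (hn : 1 ≤ n) (t : ℕ) :
    (1 - 1 / (n : ℝ)) ^ t ≤ Real.exp (-(t : ℝ) / n) := by
  have hn' : (0 : ℝ) < n := by exact_mod_cast hn
  have h0 : 0 ≤ 1 - 1 / (n : ℝ) := by
    rw [sub_nonneg, div_le_one hn']
    exact_mod_cast hn
  have h1 : 1 - 1 / (n : ℝ) ≤ Real.exp (-(1 / (n : ℝ))) := by
    have := Real.add_one_le_exp (-(1 / (n : ℝ)))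
    linarith
  calc (1 - 1 / (n : ℝ)) ^ t ≤ (Real.exp (-(1 / (n : ℝ)))) ^ t := pow_le_pow_left₀ h0 h1 t
    _ = Real.exp (-(t : ℝ) / n) := by
        rw [← Real.exp_nat_mul]
        congr 1
        ring

/-- **PROPOSITION 2.4, EQ. (2.7) (the estimate): `n(1 − 1/n)^t ≤ e^{−c}` whenever
`t ≥ n log n + cn`** — so `P{τ > ⌈n log n + cn⌉} ≤ Σ_{i=1}^{n} P(A_i) = n(1 − n⁻¹)^{⌈n log n + cn⌉}
≤ n exp(−(n log n + cn)/n) = e^{−c}`; the union bound over the events `A_i` = "type `i` not among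
the first `⌈n log n + cn⌉` coupons" lives on the trajectory space and is not formalised.
[cite: LevinPeres2017, §2.2 Prop. 2.4, eq. (2.7)] -/
theorem LevinPeres2017_prop_2_4_estimate {n : ℕ} (hn : 1 ≤ n) {c : ℝ} {t : ℕ}
    (ht : (n : ℝ) * Real.log n + c * n ≤ t) :
    (n : ℝ) * (1 - 1 / (n : ℝ)) ^ t ≤ Real.exp (-c) := by
  have hn' : (0 : ℝ) < n := by exact_mod_cast hn
  calc (n : ℝ) * (1 - 1 / (n : ℝ)) ^ t ≤ n * Real.exp (-(t : ℝ) / n) :=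
        mul_le_mul_of_nonneg_left (one_sub_inv_pow_le_exp hn t) hn'.le
    _ ≤ n * Real.exp (-(Real.log n + c)) := by
        refine mul_le_mul_of_nonneg_left (Real.exp_le_exp.2 ?_) hn'.le
        rw [div_le_iff₀ hn']
        linarith
    _ = Real.exp (-c) := by
        rw [neg_add, Real.exp_add, Real.exp_neg, Real.exp_log hn', ← mul_assoc,
          mul_inv_cancel₀ hn'.ne', one_mul]

end Literature.Probability.MarkovChains
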